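import Summits.BirchSwinnertonDyer.BirchSwinnertonDyer.Theses.ThetaPartnerAtTwo
import Summits.BirchSwinnertonDyer.BirchSwinnertonDyer.Theorems.ThetaPartnerAtTwoSignedTransportAtTwoStubSel2Tb
import HarnessLib

/-!
# `ResidualLocalTransportAtTwo` (item stmt-BirchSwinnertonDyer-21414, route `ThetaPartnerAtTwo`, child of the crux K1
# `SignedTransportAtTwo` stmt-BirchSwinnertonDyer-20333 under the W-23 split) — PROVED: it is the registered stub `stub_sel2Tb`
# of line `bridge`, landed as `Theorems/ThetaPartnerAtTwoSignedTransportAtTwoStubSel2Tb.lean` (p570334)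
# (lead prover bsd-wall-tp2-p1 g5; closes stmt-BirchSwinnertonDyer-21414)

HONEST FRAMING. One theorem whose type is LITERALLY the route decl
`Summit.BirchSwinnertonDyer.BirchSwinnertonDyer.Theses.ThetaPartnerAtTwo.ResidualLocalTransportAtTwo`; its proof is the landed
`stub_sel2Tb` (Kim 2009 Prop. 2.11–2.12 / Kobayashi §8 READ AT `2`: the Honda isomorphism `Ŵ ≅ Â` over `ℤ₂` evaluated on
`Ŵ(𝔪̄) ⊂ W(ℚ̄₂)`, the equivariant retraction along the odd torsion, residual rigidity from the `S₃`-image at `2`, transport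
`ℚ_[2] → ℚ_v`). This closes ONE child of the K1 split; the crux `SignedTransportAtTwo` still needs `LambdaDifferenceAtTwo`
(21415) and `MazurTateCongruenceAtTwoR` (21416). BSD is not proved by any of this.

References: [BDKim2009] Prop. 2.11–2.12 (p. 186); [Kobayashi2003] §8.4; [Serre1972] §5.3.
-/

set_option autoImplicit false
-- D-0017: single-problem summit, so `Summit.BirchSwinnertonDyer.BirchSwinnertonDyer.…` repeats a namespace BY DESIGN.
set_option linter.dupNamespace false

noncomputable section

namespace Summit.BirchSwinnertonDyer.BirchSwinnertonDyer.Theorems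

/-- **`ResidualLocalTransportAtTwo` holds** (the route decl, by name): on the theta habitat, at the place above `2`, there is a
`Gal(ℚ̄₂/ℚ₂)`-equivariant homomorphism `Ψ : W(ℚ̄₂) → A(ℚ̄₂)` restricting on `W[2^∞][2]` (through the chosen embeddings) to the
given equivariant `ẽ` — the landed `SignedTransportAtTwo.stub_sel2Tb`. [cite: BDKim2009, Prop. 2.11–2.12 (p. 186)]
[cite: Kobayashi2003, §8.4] [cite: Serre1972, §5.3] -/
theorem residualLocalTransportAtTwo_proof :
    Summit.BirchSwinnertonDyer.BirchSwinnertonDyer.Theses.ThetaPartnerAtTwo.ResidualLocalTransportAtTwo := by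
  unfold Summit.BirchSwinnertonDyer.BirchSwinnertonDyer.Theses.ThetaPartnerAtTwo.ResidualLocalTransportAtTwo
  exact SignedTransportAtTwo.stub_sel2Tb

end Summit.BirchSwinnertonDyer.BirchSwinnertonDyer.Theorems

end
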